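import Mathlib
import HarnessLib
import Literature.NumberTheory.GaloisRepresentations.LabelledHodgeTateWeights
import Literature.NumberTheory.PAdicHodge.FontaineDpst
import Literature.NumberTheory.GaloisRepresentations.PinnedDatumLabels

/-!
# `HodgeTatePurityDial` — the ι-HODGE–TATE PURITY DIAL of a framed ℓ-adic Galois representation is well posed
# (census twin, part 1 of 2, of the lens-6 g27 NODE `HodgeTatePurityCarving`, decomp-langlands; kit HOME/decomp-langlands-lens-6/g27/)

Pure label arithmetic over accepted declarations (`FramedGaloisRep.labelledHodgeTateWeightsAt`, `fontainePstAdicCompletion`,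
`PinnedLabel` / `PinnedLabel.conj` / `emb` rigidity of `PinnedDatumLabels`); NOTHING conjectural is asserted.  Contents:

* `ConjLabel ι τ₁ τ₂` — two labels above ℓ are ι-complex-conjugate partners (their global embeddings `K →+* ℚ̄_ℓ` differ by
  `ι⁻¹ ∘ conj ∘ ι`); `IsHodgeTatePure K ℓ ι ρ` — ONE integer `w` reflects the labelled Hodge–Tate multisets at every partner pair
  (Buzzard–Gee Conj. 3.2.2 / Rem. 3.2.3 read on the Galois side; Patrikis arXiv:1207.6724 Cor. 2.2.3's «purity constraint» at n = 1).
* `conjLabel_symm`, `conjLabel_iff_comp`, `IsHodgeTatePure.swap` — the pairing is symmetric, the dial is symmetric in the pair.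
* CM fields: `conjLabel_conj`, `emb_eq_emb_conj_of_conjLabel`, `isHodgeTatePure_iff_conj` (ι-pure ⟺ ∃ w, ∀ τ, HT(τ.conj) = w − HT(τ))
  and `isHodgeTatePure_iota_indep` — on a CM field the dial is INTRINSIC (independent of ι).
* Imaginary quadratic fields, rank 2: `parallelGapPureIQ` — REGULAR labelled weights with PARALLEL GAP force ι-purity (PROVED; the
  lemma that links the impure IQ leaf of the carving to route `NonParallelVoid` in part 2, `Theorems/HodgeTatePurityCarving.lean`).

Supports stmt-Langlands-17414 (`PrimeSwitchSplit.WeakGeometricAutomorphy`): the carving of part 2 splits that crux along `IsHodgeTatePure`.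
-/


set_option linter.dupNamespace false -- project-wide option (lakefile weak.linter.dupNamespace); `Summit.Langlands.Langlands` is the mandated namespace

namespace Summit.Langlands.Langlands.Theorems.HodgeTatePurityCarving

open scoped BigOperators Topology Manifold Classical MeasureTheory ProbabilityTheory Matrix InnerProductSpace ComplexConjugate ContinuousMap
open Filter Set Function TopologicalSpace MeasureTheory


/-! ## The dial is well posed (kernel certificates) -/

section Dial

open IsDedekindDomain NumberField Literature.NumberTheory.GaloisRepresentations Literature.NumberTheory.PAdicHodge

variable (K : Type) [Field K] [NumberField K] (ℓ : ℕ) [Fact ℓ.Prime]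

/-- `ConjLabel ι τ₁ τ₂`: the global embeddings `K → ℚ̄_ℓ` of the labels `(v₁,τ₁)`, `(v₂,τ₂)` are COMPLEX-CONJUGATE
PARTNERS after transport along `ι : ℚ̄_ℓ ≃ ℂ` (`ι ∘ e₂ = conj ∘ ι ∘ e₁`). [folklore] -/
def ConjLabel (ι : PadicAlgCl ℓ ≃+* ℂ) {v₁ v₂ : HeightOneSpectrum (𝓞 K)}
    (τ₁ : v₁.adicCompletion K →+* PadicAlgCl ℓ) (τ₂ : v₂.adicCompletion K →+* PadicAlgCl ℓ) : Prop :=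
  ∀ x : K, ι (τ₂ (algebraMap K (v₂.adicCompletion K) x)) = starRingEnd ℂ (ι (τ₁ (algebraMap K (v₁.adicCompletion K) x)))

/-- THE DIAL `D(K,ℓ,ι,ρ)`: `ρ` is **ι-Hodge–Tate pure** above `ℓ` — one integer `w` such that at every pair of ι-conjugate-partner
labels the labelled Hodge–Tate multisets (pinned Fontaine datum) are REFLECTED: `HT_(v₂,τ₂)(ρ) = w − HT_(v₁,τ₁)(ρ)`.
(Clozel's purity / Buzzard–Gee Rem. 3.2.3 read on the Galois side; Hodge symmetry `h^{p,q}_σ = h^{q,p}_{cσ}` of a pure motive.)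
The body is LITERALLY the text inserted into `B_w` (`pureb_iff_named`). [folklore] -/
def IsHodgeTatePure (ι : PadicAlgCl ℓ ≃+* ℂ) {n : ℕ} (ρ : FramedGaloisRep K (PadicAlgCl ℓ) n) : Prop :=
  ∃ w : ℤ, ∀ (v₁ : IsDedekindDomain.HeightOneSpectrum (NumberField.RingOfIntegers K)) (hv₁ : ((ℓ : ℕ) : NumberField.RingOfIntegers K) ∈ v₁.asIdeal) (v₂ : IsDedekindDomain.HeightOneSpectrum (NumberField.RingOfIntegers K)) (hv₂ : ((ℓ : ℕ) : NumberField.RingOfIntegers K) ∈ v₂.asIdeal), letI := (Literature.NumberTheory.PAdicHodge.fontainePstAdicCompletion v₁ ℓ hv₁).algebra; letI := (Literature.NumberTheory.PAdicHodge.fontainePstAdicCompletion v₂ ℓ hv₂).algebra; ∀ (τ₁ : v₁.adicCompletion K →ₐ[ℚ_[ℓ]] PadicAlgCl ℓ) (τ₂ : v₂.adicCompletion K →ₐ[ℚ_[ℓ]] PadicAlgCl ℓ), (∀ x : K, ι (τ₂ (algebraMap K (v₂.adicCompletion K) x)) = starRingEnd ℂ (ι (τ₁ (algebraMap K (v₁.adicCompletion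 K) x)))) → ρ.labelledHodgeTateWeightsAt v₂ (Literature.NumberTheory.PAdicHodge.fontainePstAdicCompletion v₂ ℓ hv₂).algebra (Literature.NumberTheory.PAdicHodge.fontainePstAdicCompletion v₂ ℓ hv₂).𝔅 τ₂.toRingHom = Multiset.map (fun k : ℤ => w - k) (ρ.labelledHodgeTateWeightsAt v₁ (Literature.NumberTheory.PAdicHodge.fontainePstAdicCompletion v₁ ℓ hv₁).algebra (Literature.NumberTheory.PAdicHodge.fontainePstAdicCompletion v₁ ℓ hv₁).𝔅 τ₁.toRingHom)

variable {K ℓ}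

/-- the partner relation is SYMMETRIC (complex conjugation is an involution). [folklore] -/
theorem conjLabel_symm (ι : PadicAlgCl ℓ ≃+* ℂ) {v₁ v₂ : HeightOneSpectrum (𝓞 K)}
    {τ₁ : v₁.adicCompletion K →+* PadicAlgCl ℓ} {τ₂ : v₂.adicCompletion K →+* PadicAlgCl ℓ}
    (h : ConjLabel K ℓ ι τ₁ τ₂) : ConjLabel K ℓ ι τ₂ τ₁ := by
  intro x
  rw [h x, starRingEnd_self_apply]

/-- the partner relation pins the second global embedding: `e₂ = ι⁻¹ ∘ conj ∘ ι ∘ e₁` (so a label has AT MOST one partner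
embedding; by rigidity of pinned labels, `PinnedLabel.eq_of_emb_eq`, at most one partner label). [folklore] -/
theorem conjLabel_iff_comp (ι : PadicAlgCl ℓ ≃+* ℂ) {v₁ v₂ : HeightOneSpectrum (𝓞 K)}
    (τ₁ : v₁.adicCompletion K →+* PadicAlgCl ℓ) (τ₂ : v₂.adicCompletion K →+* PadicAlgCl ℓ) :
    ConjLabel K ℓ ι τ₁ τ₂ ↔ τ₂.comp (algebraMap K (v₂.adicCompletion K)) =
      ι.symm.toRingHom.comp ((starRingEnd ℂ).comp (ι.toRingHom.comp (τ₁.comp (algebraMap K (v₁.adicCompletion K))))) := by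
  constructor
  · intro h
    ext x
    simp only [RingHom.comp_apply, RingEquiv.toRingHom_eq_coe, RingEquiv.coe_toRingHom]
    rw [← h x, RingEquiv.symm_apply_apply]
  · intro h x
    have hx := congrArg (fun f : K →+* PadicAlgCl ℓ => ι (f x)) h
    simpa only [RingHom.comp_apply, RingEquiv.toRingHom_eq_coe, RingEquiv.coe_toRingHom, RingEquiv.apply_symm_apply] using hx

/-- reflection `k ↦ w − k` is an involution on multisets: the purity relation at a partner pair read backwards is the same
relation (consistency of the dial with `conjLabel_symm`). [folklore] -/
theorem map_reflect_reflect (w : ℤ) (M : Multiset ℤ) :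
    Multiset.map (fun k : ℤ => w - k) (Multiset.map (fun k : ℤ => w - k) M) = M := by
  rw [Multiset.map_map]
  conv_rhs => rw [← Multiset.map_id M]
  congr 1
  funext k
  simp

/-- purity read at the swapped pair: `HT(τ₁) = w − HT(τ₂)` as well. [folklore] -/
theorem IsHodgeTatePure.swap {ι : PadicAlgCl ℓ ≃+* ℂ} {n : ℕ} {ρ : FramedGaloisRep K (PadicAlgCl ℓ) n}
    (h : IsHodgeTatePure K ℓ ι ρ) : ∃ w : ℤ, ∀ (v₁ : HeightOneSpectrum (𝓞 K)) (hv₁ : ((ℓ : ℕ) : 𝓞 K) ∈ v₁.asIdeal)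
      (v₂ : HeightOneSpectrum (𝓞 K)) (hv₂ : ((ℓ : ℕ) : 𝓞 K) ∈ v₂.asIdeal),
      letI := (fontainePstAdicCompletion v₁ ℓ hv₁).algebra; letI := (fontainePstAdicCompletion v₂ ℓ hv₂).algebra;
      ∀ (τ₁ : v₁.adicCompletion K →ₐ[ℚ_[ℓ]] PadicAlgCl ℓ) (τ₂ : v₂.adicCompletion K →ₐ[ℚ_[ℓ]] PadicAlgCl ℓ),
      ConjLabel K ℓ ι τ₁.toRingHom τ₂.toRingHom →
      ρ.labelledHodgeTateWeightsAt v₁ (fontainePstAdicCompletion v₁ ℓ hv₁).algebra (fontainePstAdicCompletion v₁ ℓ hv₁).𝔅 τ₁.toRingHom =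
        Multiset.map (fun k : ℤ => w - k)
          (ρ.labelledHodgeTateWeightsAt v₂ (fontainePstAdicCompletion v₂ ℓ hv₂).algebra (fontainePstAdicCompletion v₂ ℓ hv₂).𝔅 τ₂.toRingHom) := by
  obtain ⟨w, hw⟩ := h
  refine ⟨w, fun v₁ hv₁ v₂ hv₂ τ₁ τ₂ hC => ?_⟩
  exact hw v₂ hv₂ v₁ hv₁ τ₂ τ₁ (conjLabel_symm ι hC)

/-! ### Over a CM field the dial is INTRINSIC (ι-free): partners are the conjugate labels `PinnedLabel.conj` -/

variable [IsCMField K]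

/-- for a CM field, `(v, τ)` and its conjugate label `(c•v, τ ∘ c_v⁻¹)` are ι-partners for EVERY `ι`. [folklore] -/
theorem conjLabel_conj (ι : PadicAlgCl ℓ ≃+* ℂ) {v : HeightOneSpectrum (𝓞 K)} {hv : ((ℓ : ℕ) : 𝓞 K) ∈ v.asIdeal}
    (τ : PinnedLabel ℓ v hv) : ConjLabel K ℓ ι τ.toHom τ.conj.toHom := by
  intro x
  have h1 : τ.conj.toHom (algebraMap K _ x) = τ.conj.emb x := rfl
  have h2 : τ.toHom (algebraMap K _ x) = τ.emb x := rfl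
  rw [h1, h2, PinnedLabel.emb_conj, RingHom.comp_apply]
  have := congrArg (fun f : K →+* ℂ => f x) (conj_comp_eq (ι.toRingHom.comp τ.emb))
  simpa only [RingHom.comp_apply, RingEquiv.toRingHom_eq_coe, RingEquiv.coe_toRingHom] using this.symm

/-- for a CM field, an ι-partner of `(v₁,τ₁)` has the global embedding of the conjugate label `τ₁.conj`. [folklore] -/
theorem emb_eq_emb_conj_of_conjLabel (ι : PadicAlgCl ℓ ≃+* ℂ) {v₁ v₂ : HeightOneSpectrum (𝓞 K)}
    {hv₁ : ((ℓ : ℕ) : 𝓞 K) ∈ v₁.asIdeal} {hv₂ : ((ℓ : ℕ) : 𝓞 K) ∈ v₂.asIdeal}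
    (τ₁ : PinnedLabel ℓ v₁ hv₁) (τ₂ : PinnedLabel ℓ v₂ hv₂) (h : ConjLabel K ℓ ι τ₁.toHom τ₂.toHom) :
    τ₂.emb = τ₁.conj.emb := by
  have h' := conjLabel_conj ι τ₁
  ext x
  apply ι.injective
  have e2 : τ₂.emb x = τ₂.toHom (algebraMap K _ x) := rfl
  have e1 : τ₁.conj.emb x = τ₁.conj.toHom (algebraMap K _ x) := rfl
  rw [e2, e1, h x, h' x]

/-- **ι-FREE FORM OF THE DIAL ON CM FIELDS**: `ρ` is ι-pure iff one `w` reflects the weights at every label and ITS CONJUGATE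
LABEL (`PinnedLabel.conj`): `HT(τ.conj) = w − HT(τ)`.  (→: conjugate labels are partners; ←: a partner of `τ₁` has the
embedding of `τ₁.conj`, and pinned labelled weights depend only on the global embedding — rigidity
`labelledHodgeTateWeightsAtLabel_eq_of_emb_eq`.) [folklore] -/
theorem isHodgeTatePure_iff_conj (ι : PadicAlgCl ℓ ≃+* ℂ) {n : ℕ} (ρ : FramedGaloisRep K (PadicAlgCl ℓ) n) :
    IsHodgeTatePure K ℓ ι ρ ↔ ∃ w : ℤ, ∀ (v : HeightOneSpectrum (𝓞 K)) (hv : ((ℓ : ℕ) : 𝓞 K) ∈ v.asIdeal)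
      (τ : PinnedLabel ℓ v hv), labelledHodgeTateWeightsAtLabel ρ _ _ τ.conj =
        Multiset.map (fun k : ℤ => w - k) (labelledHodgeTateWeightsAtLabel ρ v hv τ) := by
  constructor
  · rintro ⟨w, hw⟩
    exact ⟨w, fun v hv τ => hw v hv _ _ τ (PinnedLabel.conj τ) (conjLabel_conj ι τ)⟩
  · rintro ⟨w, hw⟩
    refine ⟨w, fun v₁ hv₁ v₂ hv₂ τ₁ τ₂ hC => ?_⟩
    have hemb := emb_eq_emb_conj_of_conjLabel ι (τ₁ : PinnedLabel ℓ v₁ hv₁) (τ₂ : PinnedLabel ℓ v₂ hv₂) hC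
    have hrig := labelledHodgeTateWeightsAtLabel_eq_of_emb_eq ρ (τ₂ : PinnedLabel ℓ v₂ hv₂)
      (PinnedLabel.conj (τ₁ : PinnedLabel ℓ v₁ hv₁)) hemb
    change labelledHodgeTateWeightsAtLabel ρ v₂ hv₂ (τ₂ : PinnedLabel ℓ v₂ hv₂) =
      Multiset.map (fun k : ℤ => w - k) (labelledHodgeTateWeightsAtLabel ρ v₁ hv₁ (τ₁ : PinnedLabel ℓ v₁ hv₁))
    rw [hrig]
    exact hw v₁ hv₁ (τ₁ : PinnedLabel ℓ v₁ hv₁)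

/-- hence on a CM field **the dial does not depend on `ι`**. [folklore] -/
theorem isHodgeTatePure_iota_indep (ι ι' : PadicAlgCl ℓ ≃+* ℂ) {n : ℕ} (ρ : FramedGaloisRep K (PadicAlgCl ℓ) n) :
    IsHodgeTatePure K ℓ ι ρ ↔ IsHodgeTatePure K ℓ ι' ρ := by
  rw [isHodgeTatePure_iff_conj, isHodgeTatePure_iff_conj]


/-! ### Imaginary quadratic fields: REGULAR PARALLEL-GAP ⇒ PURE (the stub of the IQ leaf, PROVED) -/

omit [IsCMField K] in
/-- the ι-conjugate of a global embedding `e : K → ℚ̄_ℓ`: `ι⁻¹ ∘ conj ∘ ι ∘ e`. [folklore] -/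
noncomputable def cbar (ι : PadicAlgCl ℓ ≃+* ℂ) (e : K →+* PadicAlgCl ℓ) : K →+* PadicAlgCl ℓ :=
  ι.symm.toRingHom.comp ((starRingEnd ℂ).comp (ι.toRingHom.comp e))

omit [NumberField K] [IsCMField K] in
/-- `cbar ι e` evaluates to `ι.symm (conj (ι (e x)))`. [folklore] -/
theorem cbar_apply (ι : PadicAlgCl ℓ ≃+* ℂ) (e : K →+* PadicAlgCl ℓ) (x : K) :
    cbar ι e x = ι.symm (starRingEnd ℂ (ι (e x))) := rfl

omit [NumberField K] [IsCMField K] in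
/-- `cbar` is an involution. [folklore] -/
theorem cbar_cbar (ι : PadicAlgCl ℓ ≃+* ℂ) (e : K →+* PadicAlgCl ℓ) : cbar ι (cbar ι e) = e := by
  ext x
  rw [cbar_apply, cbar_apply, RingEquiv.apply_symm_apply, starRingEnd_self_apply, RingEquiv.symm_apply_apply]

omit [NumberField K] [IsCMField K] in
/-- over a TOTALLY COMPLEX field no embedding is its own ι-conjugate (`ι ∘ e` would be a real embedding). [folklore] -/
theorem cbar_ne_self [IsTotallyComplex K] (ι : PadicAlgCl ℓ ≃+* ℂ) (e : K →+* PadicAlgCl ℓ) : cbar ι e ≠ e := by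
  intro h
  apply IsTotallyComplex.complexEmbedding_not_isReal (K := K) (ι.toRingHom.comp e)
  rw [ComplexEmbedding.isReal_iff]
  ext x
  rw [ComplexEmbedding.conjugate_coe_eq]
  have hx := congrArg (fun f : K →+* PadicAlgCl ℓ => ι (f x)) h
  simp only [cbar_apply, RingEquiv.apply_symm_apply] at hx
  simpa only [RingHom.comp_apply, RingEquiv.toRingHom_eq_coe, RingEquiv.coe_toRingHom] using hx

omit [IsCMField K] in
/-- an ι-partner label has the ι-conjugate global embedding. [folklore] -/
theorem emb_eq_cbar_of_conjLabel (ι : PadicAlgCl ℓ ≃+* ℂ) {v₁ v₂ : HeightOneSpectrum (𝓞 K)}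
    {hv₁ : ((ℓ : ℕ) : 𝓞 K) ∈ v₁.asIdeal} {hv₂ : ((ℓ : ℕ) : 𝓞 K) ∈ v₂.asIdeal}
    (τ₁ : PinnedLabel ℓ v₁ hv₁) (τ₂ : PinnedLabel ℓ v₂ hv₂) (h : ConjLabel K ℓ ι τ₁.toHom τ₂.toHom) :
    τ₂.emb = cbar ι τ₁.emb := by
  ext x
  rw [cbar_apply]
  apply ι.injective
  rw [RingEquiv.apply_symm_apply]
  exact h x

omit [IsCMField K] in
/-- two-element multisets with a common gap and equal... bookkeeping: `{a', a'+g} = {b, b+g} → a' = b`. [folklore] -/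
theorem fst_eq_of_pair_gap_eq {a b g : ℤ} (h : ({a, a + g} : Multiset ℤ) = {b, b + g}) : a = b := by
  simp only [Multiset.insert_eq_cons] at h
  rw [Multiset.cons_eq_cons] at h
  simp only [Multiset.singleton_inj, Multiset.singleton_eq_cons_iff, ne_eq] at h
  rcases h with ⟨h1, -⟩ | ⟨-, cs, ⟨h1, -⟩, ⟨h2, -⟩⟩
  · exact h1
  · omega

omit [IsCMField K] in
/-- **A quadratic field has only two embeddings into `ℚ̄_ℓ`** (re-proved from `AlgHom.card`; cf. the landed
`NonParallelVoid…StubParallelOfAutomorphicTwist.emb_dichotomy`). [folklore] -/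
theorem emb_dichotomy' (hK2 : Module.finrank ℚ K = 2) {e₀ e₁ : K →+* PadicAlgCl ℓ} (h01 : e₀ ≠ e₁)
    (e : K →+* PadicAlgCl ℓ) : e = e₀ ∨ e = e₁ := by
  by_contra hne
  push Not at hne
  have hinj : ∀ f g : K →+* PadicAlgCl ℓ, f.toRatAlgHom = g.toRatAlgHom → f = g := fun f g hfg => by
    have := congrArg (fun φ : K →ₐ[ℚ] PadicAlgCl ℓ => (φ : K →+* PadicAlgCl ℓ)) hfg
    simpa using this
  have h3 : 2 < Fintype.card (K →ₐ[ℚ] PadicAlgCl ℓ) := by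
    rw [Fintype.two_lt_card_iff]
    exact ⟨e.toRatAlgHom, e₀.toRatAlgHom, e₁.toRatAlgHom, fun h => hne.1 (hinj _ _ h),
      fun h => hne.2 (hinj _ _ h), fun h => h01 (hinj _ _ h)⟩
  rw [AlgHom.card (F := ℚ) (E := K) (PadicAlgCl ℓ), hK2] at h3
  exact lt_irrefl _ h3

omit [IsCMField K] in
/-- reflecting a parallel pair: `map (a₀+a'+g − ·) {a₀, a₀+g} = {a', a'+g}`. [folklore] -/
theorem reflect_pair (a₀ a' g : ℤ) :
    Multiset.map (fun k : ℤ => a₀ + a' + g - k) ({a₀, a₀ + g} : Multiset ℤ) = {a', a' + g} := by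
  simp only [Multiset.insert_eq_cons, Multiset.map_cons, Multiset.map_singleton]
  rw [show a₀ + a' + g - a₀ = a' + g by ring, show a₀ + a' + g - (a₀ + g) = a' by ring]
  exact Multiset.cons_swap (a' + g) a' ∅  -- {a'+g, a'} = {a', a'+g}

omit [IsCMField K] in
/-- **LEAF STUB, PROVED — over an imaginary quadratic field a rank-2 representation with REGULAR, PARALLEL-GAP labelled
Hodge–Tate weights is ι-pure for every ι** (`w = a(e) + a(ē) + g`: the two global embeddings `e ≠ ē = cbar ι e` of `K` into
`ℚ̄_ℓ` exhaust the labels' embeddings, `emb_dichotomy'`; partners carry ι-conjugate embeddings; rigidity of pinned labels).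
Hence the IQ impure corner of `B_w` is EXACTLY the non-parallel corner = route `NonParallelVoid`'s `Target`
(`impureRankTwoIQ_of_void`). [folklore] -/
theorem parallelGapPureIQ : ∀ (K : Type) [Field K] [NumberField K] [Algebra.IsQuadraticExtension ℚ K], NumberField.IsTotallyComplex K → ∀ (hcpt : Literature.NumberTheory.Automorphic.isCompact_glFiniteIntegralLevel 2 K), ∀ (ℓ : ℕ) [Fact ℓ.Prime] (ι : PadicAlgCl ℓ ≃+* ℂ) (ρ : Literature.NumberTheory.GaloisRepresentations.FramedGaloisRep K (PadicAlgCl ℓ) 2), (∀ (v : IsDedekindDomain.HeightOneSpectrum (NumberField.RingOfIntegers K)) (hv : ((ℓ : ℕ) : NumberField.RingOfIntegers K) ∈ v.asIdeal), letI := (Literature.NumberTheory.PAdicHodge.fontainePstAdicCompletion v ℓ hv).algebra; ∀ τ : v.adicCompletion K →ₐ[ℚ_[ℓ]] PadicAlgCl ℓ, ∃ a b : ℤ, a < b ∧ ρ.labelledHodgeTateWeightsAt v (Literature.NumberTheory.PAdicHodge.fontainePstAdicCompletion v ℓ hv).algebra (Literature.NumberTheory.PAdicHodge.fontainePstAdicCompletion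 v ℓ hv).𝔅 τ.toRingHom = {a, b}) → (∃ g : ℤ, ∀ (v : IsDedekindDomain.HeightOneSpectrum (NumberField.RingOfIntegers K)) (hv : ((ℓ : ℕ) : NumberField.RingOfIntegers K) ∈ v.asIdeal), letI := (Literature.NumberTheory.PAdicHodge.fontainePstAdicCompletion v ℓ hv).algebra; ∀ τ : v.adicCompletion K →ₐ[ℚ_[ℓ]] PadicAlgCl ℓ, ∃ a : ℤ, ρ.labelledHodgeTateWeightsAt v (Literature.NumberTheory.PAdicHodge.fontainePstAdicCompletion v ℓ hv).algebra (Literature.NumberTheory.PAdicHodge.fontainePstAdicCompletion v ℓ hv).𝔅 τ.toRingHom = {a, a + g}) → (∃ w : ℤ, ∀ (v₁ : IsDedekindDomain.HeightOneSpectrum (NumberField.RingOfIntegers K)) (hv₁ : ((ℓ : ℕ) : NumberField.RingOfIntegers K) ∈ v₁.asIdeal) (v₂ : IsDedekindDomain.HeightOneSpectrum (NumberField.RingOfIntegers K)) (hv₂ : ((ℓ : ℕ) : NumberField.RingOfIntegers K) ∈ v₂.asIdeal), letI := (Literature.NumberTheory.PAdicHodge.fontainePstAdicCompletion v₁ ℓ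 hv₁).algebra; letI := (Literature.NumberTheory.PAdicHodge.fontainePstAdicCompletion v₂ ℓ hv₂).algebra; ∀ (τ₁ : v₁.adicCompletion K →ₐ[ℚ_[ℓ]] PadicAlgCl ℓ) (τ₂ : v₂.adicCompletion K →ₐ[ℚ_[ℓ]] PadicAlgCl ℓ), (∀ x : K, ι (τ₂ (algebraMap K (v₂.adicCompletion K) x)) = starRingEnd ℂ (ι (τ₁ (algebraMap K (v₁.adicCompletion K) x)))) → ρ.labelledHodgeTateWeightsAt v₂ (Literature.NumberTheory.PAdicHodge.fontainePstAdicCompletion v₂ ℓ hv₂).algebra (Literature.NumberTheory.PAdicHodge.fontainePstAdicCompletion v₂ ℓ hv₂).𝔅 τ₂.toRingHom = Multiset.map (fun k : ℤ => w - k) (ρ.labelledHodgeTateWeightsAt v₁ (Literature.NumberTheory.PAdicHodge.fontainePstAdicCompletion v₁ ℓ hv₁).algebra (Literature.NumberTheory.PAdicHodge.fontainePstAdicCompletion v₁ ℓ hv₁).𝔅 τ₁.toRingHom)) := by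
  intro K _ _ _ hK hcpt ℓ _ ι ρ hreg hpar
  haveI := hK
  have hK2 : Module.finrank ℚ K = 2 := Algebra.IsQuadraticExtension.finrank_eq_two ℚ K
  obtain ⟨g, hg⟩ := hpar
  obtain ⟨v₀, hv₀, ⟨τ₀⟩⟩ := exists_pinnedLabel K ℓ
  obtain ⟨a₀, ha₀⟩ := hg v₀ hv₀ τ₀
  -- every label's global embedding is `e₀ := emb τ₀` or its ι-conjugate
  have hdich : ∀ (v : HeightOneSpectrum (𝓞 K)) (hv : ((ℓ : ℕ) : 𝓞 K) ∈ v.asIdeal) (τ : PinnedLabel ℓ v hv),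
      τ.emb = τ₀.emb ∨ τ.emb = cbar ι τ₀.emb := fun v hv τ =>
    emb_dichotomy' hK2 (cbar_ne_self ι τ₀.emb).symm τ.emb
  -- labelled weights at a label with the embedding of `τ₀` are those of `τ₀`
  have hHT : ∀ (v : HeightOneSpectrum (𝓞 K)) (hv : ((ℓ : ℕ) : 𝓞 K) ∈ v.asIdeal) (τ : PinnedLabel ℓ v hv)
      (v' : HeightOneSpectrum (𝓞 K)) (hv' : ((ℓ : ℕ) : 𝓞 K) ∈ v'.asIdeal) (τ' : PinnedLabel ℓ v' hv'),
      τ.emb = τ'.emb → labelledHodgeTateWeightsAtLabel ρ v hv τ = labelledHodgeTateWeightsAtLabel ρ v' hv' τ' :=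
    fun v hv τ v' hv' τ' h => labelledHodgeTateWeightsAtLabel_eq_of_emb_eq ρ τ τ' h
  by_cases hex : ∃ (v : HeightOneSpectrum (𝓞 K)) (hv : ((ℓ : ℕ) : 𝓞 K) ∈ v.asIdeal) (τ : PinnedLabel ℓ v hv),
      τ.emb = cbar ι τ₀.emb
  · obtain ⟨v', hv', τ', he'⟩ := hex
    obtain ⟨a', ha'⟩ := hg v' hv' τ'
    refine ⟨a₀ + a' + g, fun v₁ hv₁ v₂ hv₂ τ₁ τ₂ hC => ?_⟩
    have h2 := emb_eq_cbar_of_conjLabel ι (τ₁ : PinnedLabel ℓ v₁ hv₁) (τ₂ : PinnedLabel ℓ v₂ hv₂) hC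
    change labelledHodgeTateWeightsAtLabel ρ v₂ hv₂ (τ₂ : PinnedLabel ℓ v₂ hv₂) =
      Multiset.map (fun k : ℤ => a₀ + a' + g - k) (labelledHodgeTateWeightsAtLabel ρ v₁ hv₁ (τ₁ : PinnedLabel ℓ v₁ hv₁))
    rcases hdich v₁ hv₁ (τ₁ : PinnedLabel ℓ v₁ hv₁) with h1 | h1
    · -- `τ₁ ~ τ₀`, `τ₂ ~ τ'`
      rw [h1, ← he'] at h2
      rw [hHT v₁ hv₁ τ₁ v₀ hv₀ τ₀ h1, hHT v₂ hv₂ τ₂ v' hv' τ' h2]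
      change ρ.labelledHodgeTateWeightsAt v' _ _ (PinnedLabel.toHom τ') =
        Multiset.map (fun k : ℤ => a₀ + a' + g - k) (ρ.labelledHodgeTateWeightsAt v₀ _ _ (PinnedLabel.toHom τ₀))
      rw [show ρ.labelledHodgeTateWeightsAt v' _ _ (PinnedLabel.toHom τ') = {a', a' + g} from ha',
        show ρ.labelledHodgeTateWeightsAt v₀ _ _ (PinnedLabel.toHom τ₀) = {a₀, a₀ + g} from ha₀, reflect_pair]
    · -- `τ₁ ~ τ'`, `τ₂ ~ τ₀`
      rw [h1, cbar_cbar] at h2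
      rw [← he'] at h1
      rw [hHT v₁ hv₁ τ₁ v' hv' τ' h1, hHT v₂ hv₂ τ₂ v₀ hv₀ τ₀ h2]
      change ρ.labelledHodgeTateWeightsAt v₀ _ _ (PinnedLabel.toHom τ₀) =
        Multiset.map (fun k : ℤ => a₀ + a' + g - k) (ρ.labelledHodgeTateWeightsAt v' _ _ (PinnedLabel.toHom τ'))
      rw [show ρ.labelledHodgeTateWeightsAt v' _ _ (PinnedLabel.toHom τ') = {a', a' + g} from ha',
        show ρ.labelledHodgeTateWeightsAt v₀ _ _ (PinnedLabel.toHom τ₀) = {a₀, a₀ + g} from ha₀,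
        show a₀ + a' + g = a' + a₀ + g by ring, reflect_pair]
  · -- no label carries the conjugate embedding: there are no partner pairs at all
    refine ⟨0, fun v₁ hv₁ v₂ hv₂ τ₁ τ₂ hC => ?_⟩
    exfalso
    have h2 := emb_eq_cbar_of_conjLabel ι (τ₁ : PinnedLabel ℓ v₁ hv₁) (τ₂ : PinnedLabel ℓ v₂ hv₂) hC
    rcases hdich v₁ hv₁ (τ₁ : PinnedLabel ℓ v₁ hv₁) with h1 | h1
    · rw [h1] at h2
      exact hex ⟨v₂, hv₂, τ₂, h2⟩
    · exact hex ⟨v₁, hv₁, τ₁, h1⟩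

end Dial

end Summit.Langlands.Langlands.Theorems.HodgeTatePurityCarving
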